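import Literature.AlgebraicGeometry.FundamentalGroup.ProjectiveSpace
import HarnessLib

/-!
# Étale covers of projective space: complements to `FundamentalGroup/ProjectiveSpace.lean`

Topic: `Literature/AlgebraicGeometry/FundamentalGroup`. Proved complements to the decomposition of
SGA 1, Exp. XI, Prop. 1.1 in `ProjectiveSpace.lean`:

* `surjective_of_isFinite_of_etale_projectiveSpace` — a finite étale morphism from a non-empty
  scheme to `ℙ^r_k` is surjective (its rank, Mathlib `Scheme.Hom.finrank`, Stacks 02KA, is
  locally constant on the connected `ℙ^r_k` and `≥ 1` on the image);
* `nonempty_pullback_hyperplaneEmb` — hence the hyperplane section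
  `Y ×_{ℙ^{r+1}} ℙ^r` (along `ProjectiveSpace.hyperplaneEmb`) of a non-empty finite étale
  `Y → ℙ^{r+1}_k` is non-empty. This records that the conclusion
  `ConnectedSpace (pullback π (hyperplaneEmb k (r + 1)))` of the named fact
  `EtaleCoverHyperplaneSectionConnected` — which in Mathlib includes non-emptiness — asserts no
  more than the printed "`Y'` est connexe" of SGA 1 X 2.11 (review note on p24554).

## Sources

* A. Grothendieck, M. Raynaud, SGA 1, Exp. X Cor. 2.11; Exp. XI Prop. 1.1. [SGA1]
* The Stacks Project, Tag 02KA. [StacksProject]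
-/

noncomputable section

open CategoryTheory CategoryTheory.Limits AlgebraicGeometry TopologicalSpace

namespace Literature.AlgebraicGeometry.FundamentalGroup

universe u

open Literature.AlgebraicGeometry.Motives (projectiveSpace)
open Literature.AlgebraicGeometry.Resolution (isIntegral_projectiveSpace)

/-- A finite étale morphism from a non-empty scheme to `ℙ^r_k` is surjective: its rank is locally
constant on the connected `ℙ^r_k` and `≥ 1` at a point of the image (Mathlib
`Scheme.Hom.one_le_finrank_map`, `Scheme.Hom.one_le_finrank_iff_surjective`).
[cite: StacksProject, Tag 02KA] -/
theorem surjective_of_isFinite_of_etale_projectiveSpace {k : Type u} [Field k] (r : ℕ)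
    {Y : Scheme.{u}} (π : Y ⟶ (projectiveSpace r k).left) [IsFinite π] [Etale π] [Nonempty Y] :
    Surjective π := by
  haveI := isIntegral_projectiveSpace r k
  obtain ⟨y⟩ := ‹Nonempty Y›
  have hlc := Scheme.Hom.isLocallyConstant_finrank π
  rw [← Scheme.Hom.one_le_finrank_iff_surjective, Pi.le_def]
  intro x
  rw [Pi.one_apply, hlc.apply_eq_of_preconnectedSpace x (π y)]
  exact Scheme.Hom.one_le_finrank_map π y

/-- **The hyperplane section of a non-empty finite étale cover of `ℙ^{r+1}_k` is non-empty**
(`π` is surjective and `ℙ^r_k ≠ ∅`). Hence the conclusion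
`ConnectedSpace (pullback π (hyperplaneEmb k (r + 1)))` of `EtaleCoverHyperplaneSectionConnected`
asserts no more than the printed "`Y'` est connexe" of SGA 1 X 2.11 for the (automatically
non-empty) `Y' = X' ×_{ℙ^r} H`. [folklore] -/
theorem nonempty_pullback_hyperplaneEmb {k : Type u} [Field k] (r : ℕ) {Y : Scheme.{u}}
    (π : Y ⟶ (projectiveSpace (r + 1) k).left) [IsFinite π] [Etale π] [Nonempty Y] :
    Nonempty ↥(pullback π (ProjectiveSpace.hyperplaneEmb k r)) := by
  haveI := isIntegral_projectiveSpace r k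
  haveI := surjective_of_isFinite_of_etale_projectiveSpace (r + 1) π
  obtain ⟨x⟩ : Nonempty ↥(projectiveSpace r k).left := inferInstance
  obtain ⟨y, hy⟩ := π.surjective (ProjectiveSpace.hyperplaneEmb k r x)
  obtain ⟨z, -, -⟩ := Scheme.Pullback.exists_preimage_pullback (f := π)
    (g := ProjectiveSpace.hyperplaneEmb k r) y x hy
  exact ⟨z⟩

end Literature.AlgebraicGeometry.FundamentalGroup

end
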